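import Literature.Topology.FourManifolds.LongAnnulusAxis
import Literature.Topology.FourManifolds.AxisStraighten
import HarnessLib

/-!
# Normalising the first-order data of a long annulus along its axis

Topic `Literature/Topology/FourManifolds`; fifth infrastructure file of the straightening of a
spanning arc in the proof programme of the Fox–Milnor fact
`Literature.Topology.FourManifolds.Knot.exists_isConnectedSum_isConcordant`. Everything here is
proved; no named fact is introduced.

Given a long annulus with flat collars at `θ₁` (`LongAnnulus.FlatAt`) and level-true spanning
arc (`LongAnnulus.exists_relevel`), this file produces a long annulus of the same width, with the
same end curves, whose spanning arc is the axis `{x₀} × ℝ` **and whose `θ`-derivative along the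
axis is the constant `(σ' θ₁ • e, 0)` of the flat strip** (`LongAnnulus.exists_axis_normalised`):

1. translate level-wise to the axis (`exists_isAxis_of_level_true`, `LongAnnulusAxis.lean`);
2. normalise the spatial `θ`-derivative `w t` along the axis to `w₀ = σ' θ₁ • e` by the level-wise
   linear maps `M t = A₀⁻¹ ∘ Mof (w t)`, `Mof y = (‖w₀‖/‖y‖) • rot u⋆ u₀ ∘ rot y (‖y‖ u⋆)`, where
   `rot a b = refl b ∘ refl (a + b)` is the rotation by two reflections taking `a` to `b`
   (`‖a‖ = ‖b‖`, `a + b ≠ 0`) and `u⋆` is a **generic unit vector** (off the null cone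
   `{r • w t}`, `NullImages.lean`), `A₀ = Mof w₀`; `M t = id` at collar levels since `w = w₀` there;
3. kill the level component `w₄` of the `θ`-derivative by the fibrewise level move
   `Relevel.R c w₄` with `c x = -χ x · ⟪x - x₀, w₀⟫ / ‖w₀‖²` (`χ` a bump at `x₀` of small
   support), which has `c x₀ = 0` and `Dc x₀ w₀ = -1`.

## References

* M. W. Hirsch, *Differential Topology*, GTM 33 (1976), Ch. 4 §§5–6, Ch. 8 §1. [HirschDT1976]
* H. Whitney, *Differentiable manifolds*, Ann. of Math. 37 (1936), §§5–8. [Whitney1936]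

## Design notes

No named facts, no `sorry`; `𝔼 n` is local notation as in `Knots.lean`.
-/

open scoped Topology ContDiff RealInnerProductSpace
open Function Set Metric Filter MeasureTheory

noncomputable section

namespace Literature.Topology.FourManifolds

/-- Local notation: `𝔼 n` is the model Euclidean space `EuclideanSpace ℝ (Fin n)`. -/
local notation "𝔼 " n:arg => EuclideanSpace ℝ (Fin n)

namespace AxisRot

/-! ### Reflections and rotations by two reflections -/

/-- **The reflection** in the plane orthogonal to `n`: `x ↦ x - (2 ⟪n, x⟫ / ‖n‖²) n`. [folklore] -/
def refl (n : 𝔼 3) : 𝔼 3 →L[ℝ] 𝔼 3 :=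
  ContinuousLinearMap.id ℝ (𝔼 3) - (2 / ‖n‖ ^ 2) • ((innerSL ℝ n).smulRight n)

/-- The reflection as a formula. [folklore] -/
theorem refl_apply (n x : 𝔼 3) : refl n x = x - (2 / ‖n‖ ^ 2 * ⟪n, x⟫) • n := by
  simp [refl, ContinuousLinearMap.smulRight_apply, smul_smul]

/-- The reflection negates `n` (`n ≠ 0`). [folklore] -/
theorem refl_self {n : 𝔼 3} (hn : n ≠ 0) : refl n n = -n := by
  rw [refl_apply, real_inner_self_eq_norm_sq]
  have : ‖n‖ ^ 2 ≠ 0 := pow_ne_zero _ (norm_ne_zero_iff.2 hn)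
  rw [div_mul_cancel₀ _ this, two_smul]
  abel

/-- The reflection is an involution (`n ≠ 0`). [folklore] -/
theorem refl_refl {n : 𝔼 3} (hn : n ≠ 0) (x : 𝔼 3) : refl n (refl n x) = x := by
  have h2 : ‖n‖ ^ 2 ≠ 0 := pow_ne_zero _ (norm_ne_zero_iff.2 hn)
  rw [refl_apply, refl_apply, inner_sub_right, inner_smul_right, real_inner_self_eq_norm_sq]
  have : 2 / ‖n‖ ^ 2 * (⟪n, x⟫ - 2 / ‖n‖ ^ 2 * ⟪n, x⟫ * ‖n‖ ^ 2) = -(2 / ‖n‖ ^ 2 * ⟪n, x⟫) := by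
    field_simp; ring
  rw [this, neg_smul]
  abel

/-- The reflection only depends on the line of `n`. [folklore] -/
theorem refl_smul {r : ℝ} (hr : r ≠ 0) (n : 𝔼 3) : refl (r • n) = refl n := by
  refine ContinuousLinearMap.ext fun x ↦ ?_
  rw [refl_apply, refl_apply, norm_smul, inner_smul_left, mul_pow, Real.norm_eq_abs, sq_abs,
    smul_smul]
  by_cases hn : n = 0
  · simp [hn]
  have h2 : ‖n‖ ^ 2 ≠ 0 := pow_ne_zero _ (norm_ne_zero_iff.2 hn)
  congr 1
  simp only [conj_trivial]
  field_simp

/-- The reflection applied to smooth fields is smooth where `n ≠ 0`. [folklore] -/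
theorem contDiff_refl_apply {X : Type*} [NormedAddCommGroup X] [NormedSpace ℝ X] {n v : X → 𝔼 3}
    (hn : ContDiff ℝ ∞ n) (hv : ContDiff ℝ ∞ v) (h0 : ∀ x, n x ≠ 0) :
    ContDiff ℝ ∞ fun x ↦ refl (n x) (v x) := by
  have hfun : (fun x ↦ refl (n x) (v x)) = fun x ↦ v x - (2 / ‖n x‖ ^ 2 * ⟪n x, v x⟫) • n x :=
    funext fun x ↦ refl_apply _ _
  rw [hfun]
  have h1 : ContDiff ℝ ∞ fun x ↦ 2 / ‖n x‖ ^ 2 * ⟪n x, v x⟫ :=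
    ContDiff.mul (contDiff_const.div (hn.norm_sq ℝ) fun x ↦ pow_ne_zero _ (norm_ne_zero_iff.2 (h0 x)))
      (hn.inner ℝ hv)
  exact hv.sub (h1.smul hn)

/-- **The rotation by two reflections** taking `a` to `b` (equal norms, `a + b ≠ 0`):
`rot a b = refl b ∘ refl (a + b)`. [folklore] -/
def rot (a b : 𝔼 3) : 𝔼 3 →L[ℝ] 𝔼 3 := (refl b).comp (refl (a + b))

/-- Its inverse `refl (a + b) ∘ refl b`. [folklore] -/
def rotInv (a b : 𝔼 3) : 𝔼 3 →L[ℝ] 𝔼 3 := (refl (a + b)).comp (refl b)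

/-- `rotInv ∘ rot = id` (`b ≠ 0`, `a + b ≠ 0`). [folklore] -/
theorem rotInv_rot {a b : 𝔼 3} (hb : b ≠ 0) (hab : a + b ≠ 0) (x : 𝔼 3) : rotInv a b (rot a b x) = x := by
  simp only [rot, rotInv, ContinuousLinearMap.coe_comp, comp_apply, refl_refl hb, refl_refl hab]

/-- `rot ∘ rotInv = id` (`b ≠ 0`, `a + b ≠ 0`). [folklore] -/
theorem rot_rotInv {a b : 𝔼 3} (hb : b ≠ 0) (hab : a + b ≠ 0) (x : 𝔼 3) : rot a b (rotInv a b x) = x := by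
  simp only [rot, rotInv, ContinuousLinearMap.coe_comp, comp_apply, refl_refl hb, refl_refl hab]

/-- **The rotation takes `a` to `b`** when `‖a‖ = ‖b‖`, `b ≠ 0`, `a + b ≠ 0`. [folklore] -/
theorem rot_apply_self {a b : 𝔼 3} (hab : ‖a‖ = ‖b‖) (hb : b ≠ 0) (hs : a + b ≠ 0) : rot a b a = b := by
  have hs2 : ‖a + b‖ ^ 2 ≠ 0 := pow_ne_zero _ (norm_ne_zero_iff.2 hs)
  have h1 : refl (a + b) a = -b := by
    rw [refl_apply]
    have hnorm : ‖a + b‖ ^ 2 = 2 * (‖a‖ ^ 2 + ⟪a, b⟫) := by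
      rw [norm_add_sq_real, hab]; ring
    have hinner : ⟪a + b, a⟫ = ‖a‖ ^ 2 + ⟪a, b⟫ := by
      rw [inner_add_left, real_inner_self_eq_norm_sq, real_inner_comm]
    have hne : ‖a‖ ^ 2 + ⟪a, b⟫ ≠ 0 := by
      intro h; apply hs2; rw [hnorm, h, mul_zero]
    have hcoef : 2 / ‖a + b‖ ^ 2 * ⟪a + b, a⟫ = 1 := by
      rw [hinner, hnorm]
      field_simp
    rw [hcoef, one_smul]
    abel
  rw [rot, ContinuousLinearMap.coe_comp, comp_apply, h1, map_neg, refl_self hb, neg_neg]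

/-! ### The normalising family -/

section Family

variable (w₀ ustar : 𝔼 3)

/-- `u₀ = w₀ / ‖w₀‖`. [folklore] -/
def u₀ : 𝔼 3 := ‖w₀‖⁻¹ • w₀

/-- The fixed second rotation `Ψ = rot u⋆ u₀`. [folklore] -/
def Ψ : 𝔼 3 →L[ℝ] 𝔼 3 := rot ustar (u₀ w₀)

/-- Its inverse. [folklore] -/
def Ψinv : 𝔼 3 →L[ℝ] 𝔼 3 := rotInv ustar (u₀ w₀)

/-- **The raw normalising map at the vector `y`**: `(‖w₀‖/‖y‖) • Ψ ∘ rot y (‖y‖ u⋆)`; it takes `y`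
to `w₀`. [folklore] -/
def Mof (y : 𝔼 3) : 𝔼 3 →L[ℝ] 𝔼 3 := (‖w₀‖ / ‖y‖) • ((Ψ w₀ ustar).comp (rot y (‖y‖ • ustar)))

/-- Its inverse. [folklore] -/
def MofInv (y : 𝔼 3) : 𝔼 3 →L[ℝ] 𝔼 3 := (‖y‖ / ‖w₀‖) • ((rotInv y (‖y‖ • ustar)).comp (Ψinv w₀ ustar))

variable {w₀ ustar} (hw₀ : w₀ ≠ 0) (hu : ‖ustar‖ = 1) (hsum₀ : ustar + u₀ w₀ ≠ 0)
include hw₀ hu hsum₀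

omit hu hsum₀ in
/-- `u₀` is a unit vector. [folklore] -/
theorem norm_u₀ : ‖u₀ w₀‖ = 1 := by
  rw [u₀, norm_smul, norm_inv, norm_norm, inv_mul_cancel₀ (norm_ne_zero_iff.2 hw₀)]

omit hu hsum₀ in
/-- `u₀ ≠ 0`. [folklore] -/
theorem u₀_ne_zero : u₀ w₀ ≠ 0 := by
  intro h; have := norm_u₀ hw₀; rw [h, norm_zero] at this; exact zero_ne_one this

omit hw₀ hsum₀ in
/-- `u⋆ ≠ 0`. [folklore] -/
theorem ustar_ne_zero : ustar ≠ 0 := by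
  intro h; rw [h, norm_zero] at hu; exact zero_ne_one hu

/-- `Ψ u⋆ = u₀`. [folklore] -/
theorem Ψ_ustar : Ψ w₀ ustar ustar = u₀ w₀ :=
  rot_apply_self (by rw [hu, norm_u₀ hw₀]) (u₀_ne_zero hw₀) hsum₀

omit hu in
/-- `Ψinv ∘ Ψ = id`. [folklore] -/
theorem Ψinv_Ψ (x : 𝔼 3) : Ψinv w₀ ustar (Ψ w₀ ustar x) = x :=
  rotInv_rot (u₀_ne_zero hw₀) hsum₀ x

omit hu in
/-- `Ψ ∘ Ψinv = id`. [folklore] -/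
theorem Ψ_Ψinv (x : 𝔼 3) : Ψ w₀ ustar (Ψinv w₀ ustar x) = x :=
  rot_rotInv (u₀_ne_zero hw₀) hsum₀ x

variable {y : 𝔼 3} (hy : y ≠ 0) (hsum : y + ‖y‖ • ustar ≠ 0)
include hy hsum

omit hw₀ hsum₀ hsum in
/-- `‖y‖ • u⋆ ≠ 0`. [folklore] -/
theorem smul_ustar_ne_zero : ‖y‖ • ustar ≠ 0 :=
  smul_ne_zero (norm_ne_zero_iff.2 hy) (ustar_ne_zero hu)

/-- **`Mof y` takes `y` to `w₀`.** [folklore] -/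
theorem Mof_apply_self : Mof w₀ ustar y y = w₀ := by
  have hrot : rot y (‖y‖ • ustar) y = ‖y‖ • ustar :=
    rot_apply_self (by rw [norm_smul, norm_norm, hu, mul_one]) (smul_ustar_ne_zero hu hy) hsum
  rw [Mof, FunLike.coe_smul, Pi.smul_apply, ContinuousLinearMap.coe_comp, comp_apply, hrot, map_smul,
    Ψ_ustar hw₀ hu hsum₀, smul_smul, div_mul_cancel₀ _ (norm_ne_zero_iff.2 hy), u₀, smul_smul,
    mul_inv_cancel₀ (norm_ne_zero_iff.2 hw₀), one_smul]

/-- `MofInv y ∘ Mof y = id`. [folklore] -/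
theorem MofInv_Mof (x : 𝔼 3) : MofInv w₀ ustar y (Mof w₀ ustar y x) = x := by
  have hb := smul_ustar_ne_zero hu hy
  rw [Mof, MofInv, FunLike.coe_smul, Pi.smul_apply, FunLike.coe_smul, Pi.smul_apply, map_smul,
    ContinuousLinearMap.coe_comp, ContinuousLinearMap.coe_comp, comp_apply, comp_apply,
    Ψinv_Ψ hw₀ hsum₀, rotInv_rot hb hsum, smul_smul,
    show ‖y‖ / ‖w₀‖ * (‖w₀‖ / ‖y‖) = 1 by field_simp, one_smul]

/-- `Mof y ∘ MofInv y = id`. [folklore] -/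
theorem Mof_MofInv (x : 𝔼 3) : Mof w₀ ustar y (MofInv w₀ ustar y x) = x := by
  have hb := smul_ustar_ne_zero hu hy
  rw [Mof, MofInv, FunLike.coe_smul, Pi.smul_apply, FunLike.coe_smul, Pi.smul_apply, map_smul,
    ContinuousLinearMap.coe_comp, ContinuousLinearMap.coe_comp, comp_apply, comp_apply,
    rot_rotInv hb hsum, Ψ_Ψinv hw₀ hsum₀, smul_smul,
    show ‖w₀‖ / ‖y‖ * (‖y‖ / ‖w₀‖) = 1 by field_simp, one_smul]

end Family

/-! ### Smoothness of the family along a nonvanishing field -/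

/-- Along a smooth nonvanishing field `w` with `w t + ‖w t‖ u⋆ ≠ 0`, the map
`(x, t) ↦ Mof (w t) x` is smooth. [folklore] -/
theorem contDiff_Mof_apply {w₀ ustar : 𝔼 3} {w : ℝ → 𝔼 3} (hw : ContDiff ℝ ∞ w) (h0 : ∀ t, w t ≠ 0)
    (hsum : ∀ t, w t + ‖w t‖ • ustar ≠ 0) (hu0 : ustar ≠ 0) :
    ContDiff ℝ ∞ fun q : 𝔼 3 × ℝ ↦ Mof w₀ ustar (w q.2) q.1 := by
  have hws : ContDiff ℝ ∞ fun q : 𝔼 3 × ℝ ↦ w q.2 := hw.comp contDiff_snd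
  have hnorm : ContDiff ℝ ∞ fun q : 𝔼 3 × ℝ ↦ ‖w q.2‖ := hws.norm ℝ fun q ↦ h0 q.2
  have hfun : (fun q : 𝔼 3 × ℝ ↦ Mof w₀ ustar (w q.2) q.1) = fun q ↦
      (‖w₀‖ / ‖w q.2‖) • Ψ w₀ ustar (refl (‖w q.2‖ • ustar) (refl (w q.2 + ‖w q.2‖ • ustar) q.1)) := by
    funext q
    simp [Mof, rot]
  rw [hfun]
  refine (contDiff_const.div hnorm fun q ↦ norm_ne_zero_iff.2 (h0 q.2)).smul ?_
  refine (Ψ w₀ ustar).contDiff.comp ?_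
  refine contDiff_refl_apply (hnorm.smul contDiff_const) ?_ fun q ↦ ?_
  · exact contDiff_refl_apply (hws.add (hnorm.smul contDiff_const)) contDiff_fst fun q ↦ hsum q.2
  · exact smul_ne_zero (norm_ne_zero_iff.2 (h0 q.2)) hu0

/-- The same for the inverse family. [folklore] -/
theorem contDiff_MofInv_apply {w₀ ustar : 𝔼 3} {w : ℝ → 𝔼 3} (hw : ContDiff ℝ ∞ w) (h0 : ∀ t, w t ≠ 0)
    (hsum : ∀ t, w t + ‖w t‖ • ustar ≠ 0) (hu0 : ustar ≠ 0) :
    ContDiff ℝ ∞ fun q : 𝔼 3 × ℝ ↦ MofInv w₀ ustar (w q.2) q.1 := by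
  have hws : ContDiff ℝ ∞ fun q : 𝔼 3 × ℝ ↦ w q.2 := hw.comp contDiff_snd
  have hnorm : ContDiff ℝ ∞ fun q : 𝔼 3 × ℝ ↦ ‖w q.2‖ := hws.norm ℝ fun q ↦ h0 q.2
  have hfun : (fun q : 𝔼 3 × ℝ ↦ MofInv w₀ ustar (w q.2) q.1) = fun q ↦
      (‖w q.2‖ / ‖w₀‖) • refl (w q.2 + ‖w q.2‖ • ustar) (refl (‖w q.2‖ • ustar) (Ψinv w₀ ustar q.1)) := by
    funext q
    simp [MofInv, rotInv]
  rw [hfun]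
  refine (hnorm.div_const _).smul ?_
  refine contDiff_refl_apply (hws.add (hnorm.smul contDiff_const)) ?_ fun q ↦ hsum q.2
  exact contDiff_refl_apply (hnorm.smul contDiff_const) ((Ψinv w₀ ustar).contDiff.comp contDiff_fst)
    fun q ↦ smul_ne_zero (norm_ne_zero_iff.2 (h0 q.2)) hu0

/-! ### Generic auxiliary direction -/

/-- **A unit vector off the cone of a smooth field**: for a smooth `w : ℝ → ℝ³` there is a unit
vector `u⋆` with `w t + ‖w t‖ • u⋆ ≠ 0` for all `t` (the cone `{r • w t}` is a null set, the
differentiable image of `ℝ²`, `addHaar_image_eq_zero_of_finrank_lt`; take `u⋆ = z/‖z‖` for `z` off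
it). [folklore] -/
theorem exists_unit_off_cone {w : ℝ → 𝔼 3} (hw : ContDiff ℝ ∞ w) (h0 : ∀ t, w t ≠ 0) :
    ∃ ustar : 𝔼 3, ‖ustar‖ = 1 ∧ ∀ t, w t + ‖w t‖ • ustar ≠ 0 := by
  set f : ℝ × ℝ → 𝔼 3 := fun q ↦ q.1 • w q.2 with hf
  have hfd : DifferentiableOn ℝ f univ :=
    ((contDiff_fst.smul (hw.comp contDiff_snd)).differentiable (by simp)).differentiableOn
  have hdim : Module.finrank ℝ (ℝ × ℝ) < Module.finrank ℝ (𝔼 3) := by simp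
  have hnull : (volume : Measure (𝔼 3)) (f '' univ) = 0 := addHaar_image_eq_zero_of_finrank_lt _ hdim hfd
  obtain ⟨z, -, hz⟩ := exists_mem_notMem_of_measure_zero (volume : Measure (𝔼 3)) isOpen_univ univ_nonempty hnull
  have hz0 : z ≠ 0 := fun h ↦ hz ⟨(0, 0), mem_univ _, by simp [hf, h]⟩
  have hzn : ‖z‖ ≠ 0 := norm_ne_zero_iff.2 hz0
  refine ⟨‖z‖⁻¹ • z, by rw [norm_smul, norm_inv, norm_norm, inv_mul_cancel₀ hzn], fun t h ↦ hz ?_⟩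
  -- `w t + ‖w t‖ • z/‖z‖ = 0` puts `z` on the cone
  refine ⟨(-(‖z‖ / ‖w t‖), t), mem_univ _, ?_⟩
  have hwn : ‖w t‖ ≠ 0 := norm_ne_zero_iff.2 (h0 t)
  have h' : (‖w t‖ * ‖z‖⁻¹) • z = -w t := by
    rw [← smul_smul]; exact eq_neg_of_add_eq_zero_right h
  have hcoef : ‖w t‖ * ‖z‖⁻¹ ≠ 0 := mul_ne_zero hwn (inv_ne_zero hzn)
  simp only [hf]
  calc (-(‖z‖ / ‖w t‖)) • w t = (‖w t‖ * ‖z‖⁻¹)⁻¹ • (-w t) := by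
        rw [smul_neg, ← neg_smul]; congr 1; field_simp
    _ = (‖w t‖ * ‖z‖⁻¹)⁻¹ • ((‖w t‖ * ‖z‖⁻¹) • z) := by rw [h']
    _ = z := by rw [smul_smul, inv_mul_cancel₀ hcoef, one_smul]

end AxisRot

namespace LongAnnulus

open AxisRot Relevel

variable {η : ℝ} (A : LongAnnulus η)

/-! ### The spatial `θ`-derivative along the axis -/

/-- The `θ`-derivative field along `θ = θ₁` is smooth in the level. [folklore] -/
theorem contDiff_fderiv_one_zero (θ₁ : ℝ) :
    ContDiff ℝ ∞ fun t : ℝ ↦ fderiv ℝ A.F (θ₁, t) ((1, 0) : ℝ × ℝ) :=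
  ((A.contDiff_F.fderiv_right (m := ∞) (by simp)).comp (contDiff_const.prodMk contDiff_id)).clm_apply
    contDiff_const

/-! ### The normalisation theorem -/

/-- **Normalising a level-true spanning arc to the axis with constant `θ`-derivative.** Let the
long annulus `A` have flat collars at `θ₁` (`FlatAt`, data `x₀, e, σ`) and level-true spanning
arc, `(F (θ₁, s)).2 = s` for all `s`. Then there is a long annulus `C` of the same width with the
same end curves (hence the same flat collars), with axis `{x₀} × ℝ` (`C.F (θ₁, s) = (x₀, s)`) and
with `DC.F (θ₁, s) (1, 0) = (σ' θ₁ • e, 0)` for all `s`; `C` has the same levels as `A` off the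
open middle `(1 + η, 2 - η)` and levels in the open middle where `A` has. (Translate to the axis;
rotate-and-scale the spatial `θ`-derivative to `w₀ = σ' θ₁ • e` level-wise, through a generic
auxiliary direction; then cancel its level component by a fibrewise level move.)
Hirsch (1976), Ch. 4 §§5–6. [folklore] -/
theorem exists_axis_normalised {θ₁ ζ : ℝ} {x₀ e : 𝔼 3} {σ : ℝ → ℝ} (hf : A.FlatAt θ₁ ζ x₀ e σ)
    (hlev : ∀ s, (A.F (θ₁, s)).2 = s) :
    ∃ C : LongAnnulus η, C.k₁ = A.k₁ ∧ C.k₂ = A.k₂ ∧ C.IsAxis θ₁ x₀ ∧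
      (∀ s, fderiv ℝ C.F (θ₁, s) ((1, 0) : ℝ × ℝ) = ((deriv σ θ₁ • e, 0) : 𝔼 3 × ℝ)) ∧
      (∀ p, (A.F p).2 ∉ Ioo (1 + η) (2 - η) → (C.F p).2 = (A.F p).2) ∧
      ∀ p, (A.F p).2 ∈ Ioo (1 + η) (2 - η) → (C.F p).2 ∈ Ioo (1 + η) (2 - η) := by
  have hη := A.η_pos
  -- Step 1: the axis
  obtain ⟨B, hBk₁, hBk₂, hBax, hBlev, -⟩ := A.exists_isAxis_of_level_true hf hlev
  have hfB : B.FlatAt θ₁ ζ x₀ e σ := hf.of_k_eq hBk₁ hBk₂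
  -- Step 2: the spatial `θ`-derivative along the axis and its normalisation
  set w₀ : 𝔼 3 := deriv σ θ₁ • e with hw₀def
  have hw₀ : w₀ ≠ 0 := hf.w₀_ne_zero
  set w : ℝ → 𝔼 3 := fun t ↦ (fderiv ℝ B.F (θ₁, t) ((1, 0) : ℝ × ℝ)).1 with hwdef
  set w₄ : ℝ → ℝ := fun t ↦ (fderiv ℝ B.F (θ₁, t) ((1, 0) : ℝ × ℝ)).2 with hw₄def
  have hws : ContDiff ℝ ∞ w := contDiff_fst.comp (B.contDiff_fderiv_one_zero θ₁)
  have hw₄s : ContDiff ℝ ∞ w₄ := contDiff_snd.comp (B.contDiff_fderiv_one_zero θ₁)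
  have hwne : ∀ t, w t ≠ 0 := fun t ↦ hBax.fst_fderiv_ne_zero' B hfB t
  have hw_le : ∀ t, t ≤ 1 + η → w t = w₀ ∧ w₄ t = 0 := fun t ht ↦ by
    have := hfB.fderiv_F_one_zero_of_le ht
    exact ⟨congrArg Prod.fst this, congrArg Prod.snd this⟩
  have hw_ge : ∀ t, 2 - η ≤ t → w t = w₀ ∧ w₄ t = 0 := fun t ht ↦ by
    have := hfB.fderiv_F_one_zero_of_ge ht
    exact ⟨congrArg Prod.fst this, congrArg Prod.snd this⟩
  obtain ⟨ustar, hu, hsum⟩ := exists_unit_off_cone hws hwne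
  have hu0 : ustar ≠ 0 := by intro h; rw [h, norm_zero] at hu; exact zero_ne_one hu
  have hsum₀ : ustar + u₀ w₀ ≠ 0 := by
    -- at a collar level `w = w₀`: `w₀ + ‖w₀‖ u⋆ ≠ 0`
    intro h
    have h0 := hsum 0
    rw [(hw_le 0 (by linarith)).1] at h0
    apply h0
    have : w₀ + ‖w₀‖ • ustar = ‖w₀‖ • (ustar + u₀ w₀) := by
      rw [smul_add, u₀, smul_smul, mul_inv_cancel₀ (norm_ne_zero_iff.2 hw₀), one_smul, add_comm]
    rw [this, h, smul_zero]
  -- the level-wise linear maps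
  set A₀ := Mof w₀ ustar w₀ with hA₀
  set A₀inv := MofInv w₀ ustar w₀ with hA₀inv
  have hsumw₀ : w₀ + ‖w₀‖ • ustar ≠ 0 := by
    have := hsum 0; rwa [(hw_le 0 (by linarith)).1] at this
  set M : ℝ → 𝔼 3 →L[ℝ] 𝔼 3 := fun t ↦ A₀inv.comp (Mof w₀ ustar (w t)) with hM
  set Minv : ℝ → 𝔼 3 →L[ℝ] 𝔼 3 := fun t ↦ (MofInv w₀ ustar (w t)).comp A₀ with hMinv
  have hMs : ContDiff ℝ ∞ fun q : 𝔼 3 × ℝ ↦ M q.2 q.1 :=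
    A₀inv.contDiff.comp (contDiff_Mof_apply hws hwne hsum hu0)
  have hMinvs : ContDiff ℝ ∞ fun q : 𝔼 3 × ℝ ↦ Minv q.2 q.1 := by
    have : (fun q : 𝔼 3 × ℝ ↦ Minv q.2 q.1) = (fun q : 𝔼 3 × ℝ ↦ MofInv w₀ ustar (w q.2) q.1) ∘
        fun q ↦ (A₀ q.1, q.2) := rfl
    rw [this]
    exact (contDiff_MofInv_apply hws hwne hsum hu0).comp ((A₀.contDiff.comp contDiff_fst).prodMk contDiff_snd)
  have hinv : ∀ t x, Minv t (M t x) = x := fun t x ↦ by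
    simp only [hM, hMinv, ContinuousLinearMap.coe_comp, comp_apply]
    rw [hA₀, hA₀inv, Mof_MofInv hw₀ hu hsum₀ hw₀ hsumw₀, MofInv_Mof hw₀ hu hsum₀ (hwne t) (hsum t)]
  have hMid : ∀ t, w t = w₀ → M t = ContinuousLinearMap.id ℝ (𝔼 3) := fun t ht ↦ by
    refine ContinuousLinearMap.ext fun x ↦ ?_
    simp only [hM, ContinuousLinearMap.coe_comp, comp_apply, ContinuousLinearMap.id_apply, ht]
    exact MofInv_Mof hw₀ hu hsum₀ hw₀ hsumw₀ x
  have hMw : ∀ t, M t (w t) = w₀ := fun t ↦ by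
    simp only [hM, ContinuousLinearMap.coe_comp, comp_apply]
    rw [Mof_apply_self hw₀ hu hsum₀ (hwne t) (hsum t)]
    -- `A₀inv w₀ = A₀inv (A₀ w₀) = w₀`
    conv_lhs => rw [← Mof_apply_self hw₀ hu hsum₀ hw₀ hsumw₀]
    exact MofInv_Mof hw₀ hu hsum₀ hw₀ hsumw₀ w₀
  set C₂ := B.linearWith x₀ M Minv hMs hMinvs hinv (fun t ht ↦ hMid t (hw_le t ht).1)
    (fun t ht ↦ hMid t (hw_ge t ht).1) with hC₂
  have hC₂ax : C₂.IsAxis θ₁ x₀ := B.isAxis_linearWith x₀ M Minv hMs hMinvs hinv _ _ hBax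
  have hC₂der : ∀ s, fderiv ℝ C₂.F (θ₁, s) ((1, 0) : ℝ × ℝ) = ((w₀, w₄ s) : 𝔼 3 × ℝ) := fun s ↦ by
    rw [hC₂, B.fderiv_linearWith_F_axis x₀ M Minv hMs hMinvs hinv _ _ hBax s, hMw s]
  have hfC₂ : C₂.FlatAt θ₁ ζ x₀ e σ := hfB.of_k_eq rfl rfl
  -- Step 3: cancel the level component
  have hw₄a : ∀ t, t ≤ 1 + η → w₄ t = 0 := fun t ht ↦ (hw_le t ht).2
  have hw₄b : ∀ t, 2 - η ≤ t → w₄ t = 0 := fun t ht ↦ (hw_ge t ht).2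
  have hBz : ∀ t ∉ Ioo (1 + η) (2 - η), w₄ t = 0 := fun t ht ↦ by
    rcases not_and_or.1 ht with h | h
    · exact hw₄a t (not_lt.1 h)
    · exact hw₄b t (not_lt.1 h)
  obtain ⟨K, hKpos, hK⟩ := exists_abs_deriv_le_of_eq_zero (hw₄s.of_le (by simp)) hw₄a hw₄b
  -- the coefficient `c x = -χ x ⟪x - x₀, w₀⟫ / ‖w₀‖²`
  set r : ℝ := ‖w₀‖ / (2 * K) with hr
  have hrpos : 0 < r := div_pos (norm_pos_iff.2 hw₀) (by positivity)
  let χ : ContDiffBump x₀ := ⟨r / 2, r, by positivity, by linarith⟩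
  set ℓ : 𝔼 3 → ℝ := fun x ↦ ⟪x - x₀, w₀⟫ / ‖w₀‖ ^ 2 with hℓ
  set c : 𝔼 3 → ℝ := fun x ↦ -(χ x * ℓ x) with hc
  have hℓs : ContDiff ℝ ∞ ℓ := ((contDiff_id.sub contDiff_const).inner ℝ contDiff_const).div_const _
  have hcs : ContDiff ℝ ∞ c := (χ.contDiff.mul hℓs).neg
  have hc0 : c x₀ = 0 := by simp [hc, hℓ]
  have hcK : ∀ x, |c x| * K < 1 := by
    intro x
    have hw₀n : 0 < ‖w₀‖ := norm_pos_iff.2 hw₀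
    by_cases hx : x ∈ ball x₀ r
    · have hχ : |χ x| ≤ 1 := by rw [abs_of_nonneg χ.nonneg]; exact χ.le_one
      have hℓb : |ℓ x| ≤ ‖x - x₀‖ / ‖w₀‖ := by
        rw [hℓ]; simp only
        rw [abs_div, abs_of_pos (by positivity : (0 : ℝ) < ‖w₀‖ ^ 2), div_le_div_iff₀ (by positivity) hw₀n]
        calc |⟪x - x₀, w₀⟫| * ‖w₀‖ ≤ ‖x - x₀‖ * ‖w₀‖ * ‖w₀‖ := by
              gcongr; exact abs_real_inner_le_norm _ _
          _ = ‖x - x₀‖ * ‖w₀‖ ^ 2 := by ring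
      have hxr : ‖x - x₀‖ < r := by rwa [mem_ball_iff_norm] at hx
      have hcx : |c x| ≤ ‖x - x₀‖ / ‖w₀‖ := by
        rw [hc]; simp only; rw [abs_neg, abs_mul]
        calc |χ x| * |ℓ x| ≤ 1 * (‖x - x₀‖ / ‖w₀‖) := by gcongr
          _ = ‖x - x₀‖ / ‖w₀‖ := one_mul _
      calc |c x| * K ≤ ‖x - x₀‖ / ‖w₀‖ * K := by gcongr
        _ < r / ‖w₀‖ * K := by gcongr
        _ = 1 / 2 := by rw [hr]; field_simp
        _ < 1 := by norm_num
    · have hχ0 : χ x = 0 := by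
        have : x ∉ support (χ : 𝔼 3 → ℝ) := by rw [χ.support_eq]; exact hx
        simpa using this
      simp [hc, hχ0]
  -- `Dc x₀ w₀ = -1`
  have hDc : fderiv ℝ c x₀ w₀ = -1 := by
    have hℓ0 : ℓ x₀ = 0 := by simp [hℓ]
    have hχ1 : χ x₀ = 1 := χ.one_of_mem_closedBall (mem_closedBall_self (by positivity))
    have hℓd : HasFDerivAt ℓ ((‖w₀‖ ^ 2)⁻¹ • (innerSL ℝ w₀)) x₀ := by
      have h1 : HasFDerivAt (fun x : 𝔼 3 ↦ ⟪x - x₀, w₀⟫) (innerSL ℝ w₀) x₀ := by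
        have : (fun x : 𝔼 3 ↦ ⟪x - x₀, w₀⟫) = fun x ↦ innerSL ℝ w₀ x - ⟪x₀, w₀⟫ := by
          funext x; rw [inner_sub_left, innerSL_apply_apply, real_inner_comm]
        rw [this]
        exact (innerSL ℝ w₀).hasFDerivAt.sub_const _
      have e : ℓ = fun x ↦ ⟪x - x₀, w₀⟫ * (‖w₀‖ ^ 2)⁻¹ := by funext x; rw [hℓ]; simp only; rw [div_eq_mul_inv]
      rw [e]
      exact h1.mul_const _
    have hχc : ContDiff ℝ ∞ (χ : 𝔼 3 → ℝ) := χ.contDiff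
    have hχd : HasFDerivAt (χ : 𝔼 3 → ℝ) (fderiv ℝ χ x₀) x₀ := ((hχc.differentiable (by simp)) x₀).hasFDerivAt
    have hprod := hχd.mul hℓd
    have hcd : HasFDerivAt c (-(χ x₀ • ((‖w₀‖ ^ 2)⁻¹ • innerSL ℝ w₀) + ℓ x₀ • fderiv ℝ χ x₀)) x₀ := hprod.neg
    rw [hcd.fderiv, hχ1, hℓ0]
    have hn : ‖w₀‖ ^ 2 ≠ 0 := pow_ne_zero _ (norm_ne_zero_iff.2 hw₀)
    simp [innerSL_apply_apply, hn]
  set C₃ := C₂.relevelWith c w₄ hcs hw₄s hK hcK hBz with hC₃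
  refine ⟨C₃, hBk₁, hBk₂, C₂.isAxis_relevelWith c w₄ hcs hw₄s hK hcK hBz hC₂ax hc0, fun s ↦ ?_,
    fun p hp ↦ ?_, fun p hp ↦ ?_⟩
  · rw [hC₃, C₂.fderiv_relevelWith_F_axis c w₄ hcs hw₄s hK hcK hBz hC₂ax hc0 s, hC₂der s]
    simp only
    rw [hDc]
    ext1
    · rfl
    · simp [hw₄def]
  · -- levels off the open middle
    have h2 : (C₂.F p).2 = (A.F p).2 := by rw [hC₂]; simp [hBlev p]
    show (R c w₄ (C₂.F p)).2 = (A.F p).2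
    rw [R_snd, lmap_of_not_mem hBz _ (by rw [h2]; exact hp), h2]
  · have h2 : (C₂.F p).2 = (A.F p).2 := by rw [hC₂]; simp [hBlev p]
    show (R c w₄ (C₂.F p)).2 ∈ _
    rw [R_snd]
    exact lmap_mem_Ioo hw₄s hK hcK hBz _ (by rw [h2]; exact hp)

end LongAnnulus

end Literature.Topology.FourManifolds
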